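/-
Copyright (c) 2026 the pub-hodgecm-mathlib formalisation cell (harness21).  Prover seat hodgecm-mathlib-LH3-p01 (g7); dealer LH4-plan (g7) WORD #35 (ii) «(C5)′
`…CountJPosTrace`», 2026-09-02.  Count-neutral LAYER C of the dyadic (D-UNR) column (FINDINGS #6∕#6′); CENSUS-C5 bd72510a §2 rows JPos∕Closed∕Torus, §0.4 (D1).
-/
import Literature.NumberTheory.Rogawski1990.UnitOrbitalIntegralInertCountJPos          -- ★ Prop. 10 generic (Flicker frame): `cast_index_eq`, `cast_regime_four_eq` (2-free ℚ-casts, CITED); brings `iTen`, `flickerPH∕HK∕PH0∕PHRho`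
import Literature.NumberTheory.Automorphic.UnitaryThreeTorusBlockElementsTrace            -- ★ F1 p851889: the trace torus block `M_{b,π,π′}(x₁,x₂,x₃)`, `|b| = |σb| = 1`
import Literature.NumberTheory.Rogawski1990.UnitOrbitalIntegralInertValueExponentsTrace  -- ★ (LH7-p02): `traceCorner_eq` (`(x−y)σb + (z−y)b = (x−y) + (z−x)b`), CITED
import Literature.NumberTheory.Automorphic.UnitaryThreeBorelCosetCountQuadraticTrace     -- ★ (C3c) FILE 2 p852095 (F0P3a-p09): regime four; brings ★ FILE 1 p852052 (rigid regimes, `(ν,w)` criterion, adapters)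
import HarnessLib

/-!
# Flicker's PROPOSITION 10 in the TRACE frame: the `P_H`-coset count of the trace torus block at level `j ≥ 1` equals the printed table `iTen q (N − j) N₊ m` — every
# residue characteristic (Flicker 1998 Prop. 10; LAYER C (C5)′ of the dyadic (D-UNR) column)

Topic `NumberTheory/Rogawski1990`; namespace `Literature.NumberTheory.Automorphic.UnitaryGroup` (as ★ `…CountJPos*`).  THEOREMS ONLY (no definition, no instance, no notation,
no named fact, no `sorry`); count-neutral; kernel lane `--supports stmt-HodgeConjecture-24833`.  Cell `pub/hodgecm-mathlib`, crux H413 = `stmt-HodgeConjecture-24833`; dealer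
LH4-plan (g7) WORD #35 (ii); CENSUS-C5 bd72510a (LH3-p02 (g6)) §2 rows JPos ∕ Closed ∕ Torus with (D1), my census `…/jpos/CENSUS-C5-CountJPosTrace.v1` cc353b3a.  Twin of ★
`UnitOrbitalIntegralInertCountJPos` (the dispatcher) + ★ `…CountJPosTorus` (the literal), with `hy : yσy = −2` ∕ `h2e : 2e = 1` ∕ `|2| = 1` GONE: level element `u_m^{(y,z)}`
(`z + σz + yσy = 0`), datum `UnramifiedLocalConjDatum` + `(2 : K) ≠ 0`, the torus block of ★ F1 p851889 with a FREE level `|π₁| = |ϖ^j|` (its radial conjugate is again such a block,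
§2), the coset counts of ★ (C3c) p852052∕p852095 (F0P3a-p09), the fourth-regime reading `N₁ = N₂ = N₊` by §2b (2-free) instead of ★ `v_eq_of_v_sub_lt_v_add (h2)`, the σ-defect by
the exact identity `(A−e)∕B₂ − σ((D−e)∕B₂) = (x₁−e)(e−x₃)∕(e·B₂)` (sequel `…CountJPosTorusTrace` §1, with the head AT THE LITERAL; this file = §1–§3: bookkeeping,
the radial conjugate, the 2-free fourth-regime reading, the equal-size kill and the DISPATCHER `natCard_cosets_eq_iTen_of_rel` for a general trace corner).  Prop. 8's numbers (`hidx0 hidx hSN hfib`) stay hypotheses exactly as in ★ `…CountJPos` (the (C2)′ package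
★ C2-A∕B∕C discharges them in the `…Closed` sequel, LH5-p05).  RHS `iTen` VERBATIM.  (c1)∕FINDING #19: this column carries NO class-dependent term (type B by order comparison,
type A regime four by ★ (C3c) FILE 2's simple residual root).
HONEST READER LABEL: HC_CM is proved only modulo the 7 printed citations (2 remaining named inputs: hLiu418 = stmt-HodgeConjecture-24832, h413 = stmt-HodgeConjecture-24833) until
rung 0 closes; count-neutral ((D-UNR) stays PRINT by D74′), pays no organ, opens no road.

## References
* [Flicker1998UnitaryFL] Y. Z. Flicker, *Elementary proof of the fundamental lemma for a unitary group*, Canad. J. Math. 50 (1998), §4 p. 85, Prop. 10 pp. 85–86, Cor. 9 p. 85.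
* [Rogawski1990] J. D. Rogawski, *Automorphic Representations of Unitary Groups in Three Variables* (1990), §4.9 p. 55.
-/

set_option autoImplicit false

open scoped MatrixGroups WithZero Valued
open Matrix

namespace Literature.NumberTheory.Automorphic

namespace UnitaryGroup

open Literature.NumberTheory.Automorphic.HermitianLattice (unitaryInt UnramifiedLocalConjDatum)
open Literature.NumberTheory.Rogawski1990.Flicker1998 (iTen)
open IsLocalRing

variable {K : Type*} [Field K] [Valued K ℤᵐ⁰] {ϖ : K} (σ : K →+* K) {J : Matrix (Fin 3) (Fin 3) K}

/-! ## §1 Exponent bookkeeping for `|ϖ^n|` on the UNRAMIFIED datum (★ `…CountJPos` §1 with `LocalConjDatum ↦ UnramifiedLocalConjDatum`; reads `vϖ` only) -/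

/-- `|ϖ^a| ≤ |ϖ^b| ↔ b ≤ a` (★ `v_pow_le_v_pow_iff` re-typed on `UnramifiedLocalConjDatum`). [cite: Flicker1998UnitaryFL, Prop. 10 p. 85] -/
theorem v_pow_le_v_pow_iff_of_unramified (hd : UnramifiedLocalConjDatum σ ϖ) {a b : ℕ} : Valued.v (ϖ ^ a) ≤ Valued.v (ϖ ^ b) ↔ b ≤ a := by
  rw [hd.v_pow, hd.v_pow, WithZero.exp_le_exp]; omega

/-- `|ϖ^a| < |ϖ^b| ↔ b < a` (★ `v_pow_lt_v_pow_iff` re-typed). [cite: Flicker1998UnitaryFL, Prop. 10 p. 85] -/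
theorem v_pow_lt_v_pow_iff_of_unramified (hd : UnramifiedLocalConjDatum σ ϖ) {a b : ℕ} : Valued.v (ϖ ^ a) < Valued.v (ϖ ^ b) ↔ b < a := by
  rw [hd.v_pow, hd.v_pow, WithZero.exp_lt_exp]; omega

/-- `|ϖ^a| = |ϖ^b| ↔ a = b` (★ `v_pow_eq_v_pow_iff` re-typed). [cite: Flicker1998UnitaryFL, Prop. 10 p. 85] -/
theorem v_pow_eq_v_pow_iff_of_unramified (hd : UnramifiedLocalConjDatum σ ϖ) {a b : ℕ} : Valued.v (ϖ ^ a) = Valued.v (ϖ ^ b) ↔ a = b := by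
  rw [hd.v_pow, hd.v_pow, WithZero.exp_inj]; omega

/-! ## §2 The radial conjugate of a trace torus block is a trace torus block (CENSUS §0.2 = (D1′)) -/

omit [Valued K ℤᵐ⁰] in
/-- **`(r_i)⁻¹ · M_{b,π,π′}(x₁,x₂,x₃) · r_i = M_{b, πϖ^{2i}, π′ϖ^{−2i}}(x₁,x₂,x₃)`** for `r_i = diag(ϖ^{−i}, 1, ϖ^i)`: the radial conjugate of ★ F1's trace torus block
`M_{b,π,π′}(x₁,x₂,x₃) = !![x₁σb + x₃b, 0, π(x₁ − x₃); 0, x₂, 0; π′bσb(x₁ − x₃), 0, x₁b + x₃σb]` is the trace torus block with the SAME `b`, the SAME eigen-coordinates and the pair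
`(π, π′) ↦ (π·(ϖ^iϖ^i), π′·(ϖ⁻¹)^i(ϖ⁻¹)^i)` (still `π₁π₁′ = 1`, `σπ₁ = π₁`; level `|π₁| = |ϖ|^{2i+ε}`) — so Flicker's Prop. 10 «at the torus» is ONE statement on the F1 literal with a
free level (twin of ★ `coe_radial_inv_mul_flickerTorus_mul_radial`, whose corner had equal diagonal). [cite: Flicker1998UnitaryFL, Cor. 9 p. 85; Prop. 6 p. 83] -/
theorem coe_radial_inv_mul_traceTorusBlock_mul_radial (hϖ : ϖ ≠ 0) {t r : ↥(unitaryGroupOfForm σ J)} {b π π' x₁ x₂ x₃ : K} (i : ℕ)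
    (hte : ((t : GL (Fin 3) K) : Matrix (Fin 3) (Fin 3) K) =
      !![x₁ * σ b + x₃ * b, 0, π * (x₁ - x₃); 0, x₂, 0; π' * (b * σ b * (x₁ - x₃)), 0, x₁ * b + x₃ * σ b])
    (hr : ((r : GL (Fin 3) K) : Matrix (Fin 3) (Fin 3) K) = !![ϖ⁻¹ ^ i, 0, 0; 0, 1, 0; 0, 0, ϖ ^ i]) :
    (((r⁻¹ * t * r : ↥(unitaryGroupOfForm σ J)) : GL (Fin 3) K) : Matrix (Fin 3) (Fin 3) K) =
      !![x₁ * σ b + x₃ * b, 0, (π * (ϖ ^ i * ϖ ^ i)) * (x₁ - x₃); 0, x₂, 0;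
        (π' * (ϖ⁻¹ ^ i * ϖ⁻¹ ^ i)) * (b * σ b * (x₁ - x₃)), 0, x₁ * b + x₃ * σ b] := by
  have hpi : ϖ ^ i ≠ 0 := pow_ne_zero _ hϖ
  have key : ((t : GL (Fin 3) K) : Matrix (Fin 3) (Fin 3) K) * ((r : GL (Fin 3) K) : Matrix (Fin 3) (Fin 3) K) =
      ((r : GL (Fin 3) K) : Matrix (Fin 3) (Fin 3) K) *
        !![x₁ * σ b + x₃ * b, 0, (π * (ϖ ^ i * ϖ ^ i)) * (x₁ - x₃); 0, x₂, 0;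
          (π' * (ϖ⁻¹ ^ i * ϖ⁻¹ ^ i)) * (b * σ b * (x₁ - x₃)), 0, x₁ * b + x₃ * σ b] := by
    rw [hte, hr]
    simp only [Matrix.mul_fin_three]
    ext k l
    fin_cases k <;> fin_cases l <;> simp only [Matrix.of_apply, Matrix.cons_val', Matrix.cons_val_zero, Matrix.cons_val_one,
      Matrix.cons_val_fin_one, Matrix.cons_val, Matrix.empty_val', Fin.mk_one, Fin.zero_eta, Fin.reduceFinMk, mul_zero, zero_mul,
      add_zero, zero_add, mul_one, one_mul, inv_pow]
    all_goals field_simp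
  rw [Subgroup.coe_mul, Subgroup.coe_mul, Units.val_mul, Units.val_mul, Matrix.mul_assoc, key, ← Matrix.mul_assoc, Subgroup.coe_inv,
    Units.inv_mul, Matrix.one_mul]

omit [Valued K ℤᵐ⁰] in
/-- The new pair still multiplies to one: `(π(ϖ^iϖ^i))·(π′(ϖ⁻¹)^i(ϖ⁻¹)^i) = ππ′ = 1`. [cite: Flicker1998UnitaryFL, Cor. 9 p. 85] -/
theorem radialPair_mul_eq_one (hϖ : ϖ ≠ 0) {π π' : K} (hππ : π * π' = 1) (i : ℕ) :
    (π * (ϖ ^ i * ϖ ^ i)) * (π' * (ϖ⁻¹ ^ i * ϖ⁻¹ ^ i)) = 1 := by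
  have hpi : ϖ ^ i ≠ 0 := pow_ne_zero _ hϖ
  rw [inv_pow]
  field_simp
  linear_combination hππ

omit [Valued K ℤᵐ⁰] in
/-- The new `π₁ = π·ϖ^iϖ^i` is `σ`-fixed when `π` and `ϖ` are. [cite: Flicker1998UnitaryFL, Cor. 9 p. 85] -/
theorem map_radialPair_fst (hσϖ : σ ϖ = ϖ) {π : K} (hσπ : σ π = π) (i : ℕ) : σ (π * (ϖ ^ i * ϖ ^ i)) = π * (ϖ ^ i * ϖ ^ i) := by
  rw [map_mul, map_mul, map_pow, hσπ, hσϖ]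

/-- The level of the new pair: `|π·ϖ^iϖ^i| = |ϖ^{2i+ε}|` when `|π| = |ϖ^ε|`. [cite: Flicker1998UnitaryFL, Cor. 9 p. 85] -/
theorem v_radialPair_fst {π : K} {ε : ℕ} (hπ : Valued.v π = Valued.v (ϖ ^ ε)) (i : ℕ) :
    Valued.v (π * (ϖ ^ i * ϖ ^ i)) = Valued.v (ϖ ^ (2 * i + ε)) := by
  rw [map_mul, map_mul, hπ, ← map_mul, ← map_mul, ← pow_add, ← pow_add]
  congr 2; ring

/-! ## §2b The 2-free reading of the fourth regime: `|A − x₂| > |x₁ − x₃| ⇒ |x₁ − x₂| = |x₃ − x₂| = |A − x₂|` (replaces ★ `v_eq_of_v_sub_lt_v_add (h2 : |2| = 1)`) -/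

/-- **THE FOURTH-REGIME READING WITHOUT `|2| = 1`**: if the diagonal defect `A − x₂ = (x₁ − x₂)σb + (x₃ − x₂)b` of the trace block is STRICTLY LARGER than `|x₁ − x₃|`
(Flicker's «`N₊ < N`»), then `|x₁ − x₂| = |x₃ − x₂| = |A − x₂|` — ultrametrically from `A − x₂ = (x₁ − x₂) + (x₃ − x₁)b`, `|b| = 1` (★ F1 `v_eq_one_of_add_map_eq_one`, from
`b + σb = 1`, `|b| ≤ 1` alone); replaces ★ `…CountJPosTorus.v_eq_of_v_sub_lt_v_add (h2 : |2| = 1)` («`|x − y| < |x + y| ⇒ |x| = |y| = |x + y|`») at every residue characteristic.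
[cite: Flicker1998UnitaryFL, §4 p. 85; Prop. 10 p. 86] -/
theorem v_eq_of_v_sub_lt_v_traceDefect (hσv : ∀ z, Valued.v (σ z) = Valued.v z) {b : K} (hb : b + σ b = 1) (hbv : Valued.v b ≤ 1) {x₁ x₂ x₃ : K}
    (h : Valued.v (x₁ - x₃) < Valued.v ((x₁ - x₂) * σ b + (x₃ - x₂) * b)) :
    Valued.v (x₁ - x₂) = Valued.v ((x₁ - x₂) * σ b + (x₃ - x₂) * b) ∧
      Valued.v (x₃ - x₂) = Valued.v ((x₁ - x₂) * σ b + (x₃ - x₂) * b) := by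
  obtain ⟨hvb, -, -⟩ := v_eq_one_of_add_map_eq_one σ hσv hbv hb
  have hid := traceCorner_eq σ hb x₁ x₂ x₃
  have h31 : Valued.v ((x₃ - x₁) * b) = Valued.v (x₁ - x₃) := by
    rw [map_mul, hvb, mul_one, ← neg_sub, Valuation.map_neg]
  -- `|(x₃ − x₁)b| < |x₁ − x₂|`, else `|A − x₂| ≤ |x₁ − x₃|`
  have hlt : Valued.v ((x₃ - x₁) * b) < Valued.v (x₁ - x₂) := by
    by_contra hge
    rw [not_lt] at hge
    have : Valued.v ((x₁ - x₂) * σ b + (x₃ - x₂) * b) ≤ Valued.v (x₁ - x₃) := by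
      rw [hid, ← h31]
      exact (Valuation.map_add _ _ _).trans (max_le hge le_rfl)
    exact absurd h (not_lt.2 this)
  have hA : Valued.v ((x₁ - x₂) * σ b + (x₃ - x₂) * b) = Valued.v (x₁ - x₂) := by
    rw [hid, Valuation.map_add_eq_of_lt_left _ hlt]
  refine ⟨hA.symm, ?_⟩
  rw [hA, show x₃ - x₂ = (x₁ - x₂) + (x₃ - x₁) by ring]
  have hlt' : Valued.v (x₃ - x₁) < Valued.v (x₁ - x₂) := by rwa [h31, ← neg_sub, Valuation.map_neg] at hlt
  exact Valuation.map_add_eq_of_lt_left _ hlt'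


/-! ## §3 PROPOSITION 10 for a general trace corner `(A, B₁; B₂, D)` ∈ H: the dispatcher over the (C3c) coset counts, Prop. 8's numbers as hypotheses -/

section PropTen

variable [IsDiscreteValuationRing 𝒪[K]] [Finite (ResidueField 𝒪[K])] [IsAdicComplete (maximalIdeal 𝒪[K]) 𝒪[K]]

omit [IsDiscreteValuationRing 𝒪[K]] [Finite (ResidueField 𝒪[K])] [IsAdicComplete (maximalIdeal 𝒪[K]) 𝒪[K]] in
/-- **The equal-size kill (the LITERAL's half of ★ `…_eq_zero_of_ne`)**: if `|A − b| = |ϖ^{N₊}|` STRICTLY EXCEEDS `|B₂|` and `|t|²`, and the two diagonal defects are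
close (`|A − D| < |B₂|`), then NO coset of `P_H ∩ H^K_m` in `P_H` conjugates `τ` into `H^K_m`: in (4′) the linear part `(A−b)w + (D−b)σw = (A−b)(w+σw) − (A−D)σw` has valuation
EXACTLY `|A − b|` (the trace `w + σw = −yσy` is a unit, `|A − D| < |B₂| < |A − b|`), and it dominates `B₁ν⁻¹` (`< |B₂|`) and the norm term (`= |B₂|`). 2-free.
[cite: Flicker1998UnitaryFL, Prop. 10 p. 86] -/
theorem natCard_cosets_eq_zero_of_lt_defect_of_rel (hJ : J = (StdForm.antidiagonal 3).over K) (hd : UnramifiedLocalConjDatum σ ϖ) (h2 : (2 : K) ≠ 0)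
    {y z : K} (hy : Valued.v y = 1) (hzv : Valued.v z ≤ 1) (hz : z + σ z + y * σ y = 0) (m : ℕ)
    {c um τ : ↥(unitaryGroupOfForm σ J)} (hc : ((c : GL (Fin 3) K) : Matrix (Fin 3) (Fin 3) K) = !![1, 0, 0; 0, -1, 0; 0, 0, 1])
    (hum : ((um : GL (Fin 3) K) : Matrix (Fin 3) (Fin 3) K) = !![ϖ ^ m, y, z * (ϖ ^ m)⁻¹; 0, 1, -σ y * (ϖ ^ m)⁻¹; 0, 0, (ϖ ^ m)⁻¹])
    {A B₁ B₂ D b p : K} (hB₁ : B₁ = B₂ * p) (hvp : Valued.v p < 1) (hB₂0 : B₂ ≠ 0)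
    (hτ : ((τ : GL (Fin 3) K) : Matrix (Fin 3) (Fin 3) K) = !![A, 0, B₁; 0, b, 0; B₂, 0, D])
    (hτH : τ ∈ Subgroup.centralizer ({c} : Set ↥(unitaryGroupOfForm σ J)))
    (hAD : Valued.v (A - D) < Valued.v B₂) (hB₂A : Valued.v B₂ < Valued.v (A - b)) (hbig : Valued.v (ϖ ^ m) * Valued.v (ϖ ^ m) < Valued.v (A - b)) :
    Nat.card {y : ↥(flickerPH σ J c) ⧸ (flickerHK σ J c um).subgroupOf (flickerPH σ J c) //
      ((Quotient.out y : ↥(flickerPH σ J c)) : ↥(unitaryGroupOfForm σ J))⁻¹ * τ * (Quotient.out y : ↥(flickerPH σ J c)) ∈ flickerHK σ J c um} = 0 := by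
  refine natCard_cosets_eq_zero_of_forall_coord_not σ hJ hd.σσ hd.vσ h2 hc fun p' hp u x w₀ hpm hvu hvx hσx hvw _ hmem => ?_
  have hu0 : u ≠ 0 := fun h => by rw [h, map_zero] at hvu; exact zero_ne_one hvu
  have hσu0 : σ u ≠ 0 := fun h => hu0 (by rw [← hd.σσ u, h, map_zero])
  have hw0 : w₀ ≠ 0 := fun h => by rw [h, map_zero] at hvw; exact zero_ne_one hvw
  have hpH : p' ∈ Subgroup.centralizer ({c} : Set ↥(unitaryGroupOfForm σ J)) := ((mem_flickerPH_iff h2 hc).1 hp).1.1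
  obtain ⟨-, -, -, h₄⟩ := (borel_conj_mem_flickerHK_iff_of_rel_normForm σ hJ hd hy hz m hu0 hσu0 hw0 hσx hum hpm hτ hpH hτH rfl).1 hmem
  obtain ⟨-, hσwv, hw1, hσw1, hN⟩ := trace_fibre_coord σ hd hy hzv hz hvx hσx
  set w : K := x + z with hwdef
  set ν' : K := u * σ u with hνdef
  have hν : Valued.v ν' = 1 := by rw [hνdef, map_mul, hd.vσ, hvu, mul_one]
  have hν0 : ν' ≠ 0 := fun h => by rw [h, map_zero] at hν; exact zero_ne_one hν
  -- the trace of `w` is the unit `−yσy`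
  have htr : w + σ w = -(y * σ y) := by rw [hwdef, map_add, hσx]; linear_combination hz
  have htrv : Valued.v (w + σ w) = 1 := by rw [htr, Valuation.map_neg, map_mul, hd.vσ, hy, mul_one]
  -- the linear part `(A−b)w + (D−b)σw = (A−b)(w+σw) − (A−D)σw` has valuation `|A − b|`
  have hlin : Valued.v ((A - b) * w + (D - b) * σ w) = Valued.v (A - b) := by
    have e : (A - b) * w + (D - b) * σ w = (A - b) * (w + σ w) + (-((A - D) * σ w)) := by ring
    have h1 : Valued.v ((A - b) * (w + σ w)) = Valued.v (A - b) := by rw [map_mul, htrv, mul_one]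
    have h2' : Valued.v (-((A - D) * σ w)) < Valued.v ((A - b) * (w + σ w)) := by
      rw [Valuation.map_neg, map_mul, hσw1, mul_one, h1]; exact lt_trans hAD hB₂A
    rw [e, Valuation.map_add_eq_of_lt_left _ h2', h1]
  -- the other two terms are `< |A − b|`
  have hB₂pos : 0 < Valued.v B₂ := (Valuation.pos_iff _).2 hB₂0
  have t1 : Valued.v (B₁ * ν'⁻¹) < Valued.v (A - b) := by
    rw [hB₁, map_mul, map_mul, map_inv₀, hν, inv_one, mul_one]
    exact lt_trans (mul_lt_of_lt_one_right hB₂pos hvp) hB₂A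
  have t2 : Valued.v (ν' * B₂ * (w * σ w)) < Valued.v (A - b) := by
    rw [map_mul, map_mul, hν, hN, one_mul, mul_one]; exact hB₂A
  have hsum : Valued.v (B₁ * ν'⁻¹ + (A - b) * w + (D - b) * σ w + ν' * B₂ * (w * σ w)) = Valued.v (A - b) := by
    have e : B₁ * ν'⁻¹ + (A - b) * w + (D - b) * σ w + ν' * B₂ * (w * σ w) =
        ((A - b) * w + (D - b) * σ w) + (B₁ * ν'⁻¹ + ν' * B₂ * (w * σ w)) := by ring
    have hsmall : Valued.v (B₁ * ν'⁻¹ + ν' * B₂ * (w * σ w)) < Valued.v ((A - b) * w + (D - b) * σ w) := by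
      rw [hlin]; exact lt_of_le_of_lt (Valuation.map_add _ _ _) (max_lt t1 t2)
    rw [e, Valuation.map_add_eq_of_lt_left _ hsmall, hlin]
  rw [hsum] at h₄
  exact absurd (lt_of_lt_of_le hbig h₄) (lt_irrefl _)

/-- **FLICKER'S PROPOSITION 10 FOR A TRACE CORNER** (`j ≥ 1`): for `τ = !![A,0,B₂p; 0,b,0; B₂,0,D] ∈ H` with `|B₂| = |ϖ^ν|`, `|p| < 1`, `σp = p`, `|A − b| = |ϖ^{N₊}|` and
the two diagonal defects CLOSE (`|A − D| < |B₂|` — the trace literal at `j ≥ 1`), the number of cosets `y ∈ P_H ⧸ (P_H ∩ H^K_m)` with `y⁻¹ τ y ∈ H^K_m` is the printed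
table ★ `iTen q ν N₊ m` — given Prop. 8's index (`hidx0`, `hidx`), the fibre size `q^m` of `ρ_m` (`hfib`) and `hSN` (the (C2)′ package supplies them), and the σ-defect `hσd`
of the fourth regime WITHOUT the factor `2` ((C3c) FILE 2's token).  Six-way dispatch VERBATIM from ★ `natCard_cosets_eq_iTen` over the (C3c) counts; the regime
«`ν ≠ N₊` beyond the square root» splits into «`|B₂|` dominates» ((C3c)) and the equal-size kill `natCard_cosets_eq_zero_of_lt_defect_of_rel`. [cite: Flicker1998UnitaryFL, Prop. 10 pp. 85–86] -/
theorem natCard_cosets_eq_iTen_of_rel (hJ : J = (StdForm.antidiagonal 3).over K) (hd : UnramifiedLocalConjDatum σ ϖ) (h2 : (2 : K) ≠ 0)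
    (hσO : ∀ y : 𝒪[K], (σ.comp 𝒪[K].subtype) y ∈ 𝒪[K]) {y z : K} (hy : Valued.v y = 1) (hzv : Valued.v z ≤ 1) (hz : z + σ z + y * σ y = 0)
    {m ν Np : ℕ}
    {c um τ : ↥(unitaryGroupOfForm σ J)} (hc : ((c : GL (Fin 3) K) : Matrix (Fin 3) (Fin 3) K) = !![1, 0, 0; 0, -1, 0; 0, 0, 1])
    (hum : ((um : GL (Fin 3) K) : Matrix (Fin 3) (Fin 3) K) = !![ϖ ^ m, y, z * (ϖ ^ m)⁻¹; 0, 1, -σ y * (ϖ ^ m)⁻¹; 0, 0, (ϖ ^ m)⁻¹])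
    {A B₁ B₂ D b p : K} (hB₁ : B₁ = B₂ * p) (hvp : Valued.v p < 1) (hσp : σ p = p)
    (hτ : ((τ : GL (Fin 3) K) : Matrix (Fin 3) (Fin 3) K) = !![A, 0, B₁; 0, b, 0; B₂, 0, D])
    (hτH : τ ∈ Subgroup.centralizer ({c} : Set ↥(unitaryGroupOfForm σ J)))
    (hB₂ : Valued.v B₂ = Valued.v (ϖ ^ ν)) (hs : Valued.v (A - b) = Valued.v (ϖ ^ Np)) (hAD : Valued.v (A - D) < Valued.v B₂)
    (hσd : Np = ν → m ≤ ν → ν < 2 * m → Valued.v (σ ((A - b) / B₂) - (D - b) / B₂) ≤ Valued.v (ϖ ^ (2 * m - ν)))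
    {q : ℕ} (hq : Nat.card (ResidueField 𝒪[K]) = q ^ 2)
    {a₀ : 𝒪[K]} (ha₀ : IsUnit (((σ.comp 𝒪[K].subtype).codRestrict 𝒪[K] hσO) a₀ - a₀))
    (hidx0 : m = 0 → ((flickerHK σ J c um).subgroupOf (flickerPH σ J c)).index = 1)
    (hidx : 1 ≤ m → ((flickerHK σ J c um).subgroupOf (flickerPH σ J c)).index = (q ^ 2 - 1) * q ^ (4 * m - 2))
    (hSN : flickerPH σ J c ⊓ flickerHK σ J c um ≤ flickerPH0 σ J c (ϖ ^ m))
    [Finite (↥(flickerPH σ J c) ⧸ (flickerHK σ J c um).subgroupOf (flickerPH σ J c))]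
    (hfib : ∀ z ∈ Set.range (fun w : ↥(flickerPH σ J c) ⧸ (flickerHK σ J c um).subgroupOf (flickerPH σ J c) =>
        flickerPHRho σ m ((Quotient.out w : ↥(flickerPH σ J c)) : ↥(unitaryGroupOfForm σ J))),
      Nat.card {w : ↥(flickerPH σ J c) ⧸ (flickerHK σ J c um).subgroupOf (flickerPH σ J c) //
        flickerPHRho σ m ((Quotient.out w : ↥(flickerPH σ J c)) : ↥(unitaryGroupOfForm σ J)) = z} = q ^ m) :
    (Nat.card {w : ↥(flickerPH σ J c) ⧸ (flickerHK σ J c um).subgroupOf (flickerPH σ J c) //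
      ((Quotient.out w : ↥(flickerPH σ J c)) : ↥(unitaryGroupOfForm σ J))⁻¹ * τ * (Quotient.out w : ↥(flickerPH σ J c)) ∈ flickerHK σ J c um} : ℚ) =
      iTen q ν Np m := by
  have hq0 : q ≠ 0 := by
    rintro rfl
    have h1 : 0 < Nat.card (ResidueField 𝒪[K]) := Nat.card_pos
    rw [hq] at h1; simp at h1
  have hϖ0 : ϖ ≠ 0 := hd.ϖ_ne_zero
  have hB₂0 : B₂ ≠ 0 := fun h => by
    rw [h, map_zero] at hB₂; exact (pow_ne_zero _ hϖ0) ((map_eq_zero _).1 hB₂.symm)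
  have hvmm : Valued.v (ϖ ^ m) * Valued.v (ϖ ^ m) = Valued.v (ϖ ^ (2 * m)) := by rw [← map_mul, ← pow_add, two_mul]
  -- `|D − b| ≤ max(|A − b|, |A − D|)` and, when `|A − D| < |A − b|`, `|D − b| = |A − b|`
  have hDb : D - b = (A - b) - (A - D) := by ring
  have hvD : Valued.v (D - b) ≤ max (Valued.v (A - b)) (Valued.v (A - D)) := by rw [hDb]; exact Valuation.map_sub _ _ _
  rcases Nat.eq_zero_or_pos m with hm0 | hm
  · -- m = 0 : everything solves, one coset
    subst hm0
    have hall := natCard_cosets_eq_index_of_le_of_rel σ hJ hd h2 hy hzv hz 0 hc hum hB₁ hvp.le hτ hτH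
      (by rw [hs, hvmm, v_pow_le_v_pow_iff_of_unramified σ hd]; omega)
      (le_trans hvD (max_le (by rw [hs, hvmm, v_pow_le_v_pow_iff_of_unramified σ hd]; omega)
        (le_trans hAD.le (by rw [hB₂, hvmm, v_pow_le_v_pow_iff_of_unramified σ hd]; omega))))
      (by rw [hB₂, hvmm, v_pow_le_v_pow_iff_of_unramified σ hd]; omega)
    rw [hall, hidx0 rfl, iTen, if_pos rfl, Nat.cast_one]
  have hm0 : m ≠ 0 := by omega
  by_cases hνm : ν < m
  · -- regime «m > ν» : empty
    rw [natCard_cosets_eq_zero_of_lt_of_rel σ hJ hd h2 hy hzv hz m hc hum hB₁ hvp hB₂0 hτ hτH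
        (by rw [hB₂, v_pow_lt_v_pow_iff_of_unramified σ hd]; exact hνm),
      iTen, if_neg hm0, if_neg (by omega), if_neg (by omega), Nat.cast_zero]
  have hmν : m ≤ ν := by omega
  have hB₂m : Valued.v B₂ ≤ Valued.v (ϖ ^ m) := by rw [hB₂, v_pow_le_v_pow_iff_of_unramified σ hd]; exact hmν
  by_cases hNp : Np < m
  · -- regime «N₊ < m» : an eigen-congruence fails
    rw [natCard_cosets_eq_zero_of_lt_sub_of_rel σ hJ hd h2 hy hzv hz m hc hum hτ hτH hB₂m
        (Or.inl (by rw [hs, v_pow_lt_v_pow_iff_of_unramified σ hd]; exact hNp)),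
      iTen, if_neg hm0, if_neg (by omega), if_neg (by omega), Nat.cast_zero]
  have hmNp : m ≤ Np := by omega
  by_cases hboth : 2 * m ≤ ν ∧ 2 * m ≤ Np
  · -- regime «all» : the full index
    have hall := natCard_cosets_eq_index_of_le_of_rel σ hJ hd h2 hy hzv hz m hc hum hB₁ hvp.le hτ hτH
      (by rw [hs, hvmm, v_pow_le_v_pow_iff_of_unramified σ hd]; exact hboth.2)
      (le_trans hvD (max_le (by rw [hs, hvmm, v_pow_le_v_pow_iff_of_unramified σ hd]; exact hboth.2)
        (le_trans hAD.le (by rw [hB₂, hvmm, v_pow_le_v_pow_iff_of_unramified σ hd]; exact hboth.1))))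
      (by rw [hB₂, hvmm, v_pow_le_v_pow_iff_of_unramified σ hd]; exact hboth.1)
    rw [hall, hidx hm, cast_index_eq hq0 hm, iTen, if_neg hm0, if_pos (by omega)]
  by_cases hνNp : Np = ν
  · -- regime «ν = N₊ < 2m» : the quadratic count ((C3c) FILE 2)
    subst hνNp
    have hν2m : Np < 2 * m := by omega
    obtain ⟨r, hr⟩ : ∃ r, Np = m + r := ⟨Np - m, by omega⟩
    obtain ⟨k', hk'⟩ : ∃ k', m = k' + 1 + r := ⟨m - r - 1, by omega⟩
    have hsD : Valued.v (D - b) = Valued.v (ϖ ^ Np) := by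
      rw [hDb, Valuation.map_sub_eq_of_lt_left _ (by rw [hs]; exact lt_of_lt_of_le hAD (le_of_eq hB₂)), hs]
    have hreg := natCard_cosets_regime_four_of_rel σ hJ hd h2 hσO hy hzv hz (k := k' + 1) hm hmν (by omega) (by omega) hc hum hB₁ hvp hσp hτ hτH
      hB₂ hsD hAD (by have := hσd rfl hmν hν2m; rwa [show 2 * m - Np = k' + 1 by omega] at this) hq ha₀ hSN hfib
    rw [hreg, iTen, if_neg hm0, if_neg (by omega), if_pos ⟨rfl, hν2m, hmν⟩,
      show m - (k' + 1) = r by omega, show m - 1 = k' + r by omega, hk', cast_regime_four_eq hq0 k' r]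
    congr 2; omega
  · -- regime «ν ≠ N₊ beyond the square root» : no solution
    rcases lt_or_gt_of_ne hνNp with hlt | hgt
    · -- `N₊ < ν`: `|A − b| > |B₂|`, equal sizes — the equal-size kill
      have hB₂A : Valued.v B₂ < Valued.v (A - b) := by rw [hB₂, hs, v_pow_lt_v_pow_iff_of_unramified σ hd]; exact hlt
      have hbig : Valued.v (ϖ ^ m) * Valued.v (ϖ ^ m) < Valued.v (A - b) := by
        rw [hvmm, hs, v_pow_lt_v_pow_iff_of_unramified σ hd]; omega
      rw [natCard_cosets_eq_zero_of_lt_defect_of_rel σ hJ hd h2 hy hzv hz m hc hum hB₁ hvp hB₂0 hτ hτH hAD hB₂A hbig,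
        iTen, if_neg hm0, if_neg (by omega), if_neg (by rintro ⟨h, -, -⟩; exact hνNp h.symm), Nat.cast_zero]
    · -- `ν < N₊`: `|B₂|` dominates
      have hAB₂ : Valued.v (A - b) < Valued.v B₂ := by rw [hB₂, hs, v_pow_lt_v_pow_iff_of_unramified σ hd]; exact hgt
      have hmax : max (Valued.v (A - b)) (Valued.v (D - b)) < Valued.v B₂ :=
        max_lt hAB₂ (lt_of_le_of_lt hvD (max_lt hAB₂ hAD))
      have hbig : Valued.v (ϖ ^ m) * Valued.v (ϖ ^ m) < Valued.v B₂ := by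
        rw [hvmm, hB₂, v_pow_lt_v_pow_iff_of_unramified σ hd]; omega
      rw [natCard_cosets_eq_zero_of_max_lt_of_rel σ hJ hd h2 hy hzv hz m hc hum hB₁ hvp hB₂0 hτ hτH hmax hbig,
        iTen, if_neg hm0, if_neg (by omega), if_neg (by rintro ⟨h, -, -⟩; exact hνNp h.symm), Nat.cast_zero]

end PropTen

end UnitaryGroup

end Literature.NumberTheory.Automorphic
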